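import Literature.Geometry.Kaehler.ComplexTorusFourierIsomorphism
import Literature.Geometry.Kaehler.ComplexTorusIntegralHodgeClasses
import HarnessLib

/-!
# The Fourier transform identifies the Hodge classes of `X` and of `X̂` (Lange 2023, Prop. 6.2.20–6.2.21)

Layer `Literature/Geometry/Kaehler`, namespace `Literature.Geometry.Kaehler.ComplexTorus`; lane
`lit-hodgefound` (Track 2 foundations library), Layer A4, row A4-42 of the skeleton. A short sequel of
`ComplexTorusFourierCohomology.lean` / `ComplexTorusFourierIsomorphism.lean` (the Fourier transform
`F : Hᵖ(X, ℂ) → H^{2g-p}(X̂, ℂ)` on invariant forms of the complex torus `X = E/Φ(ℤ^ι)`, with values on the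
dual torus `X̂ = Ω̄/Λ̂`, `Ω̄ = E →L⋆[ℂ] ℂ`, period `dualPeriod Φ`; there: `F` is an isomorphism
`Hᵖ(X, ℤ) → H^{2g-p}(X̂, ℤ)` — Lange 2023, Prop. 6.2.20 — and `F(H^{r,s}(X)) = H^{g-s,g-r}(X̂)` —
Prop. 6.2.21) and of `ComplexTorusHodgeClasses.lean` / `ComplexTorusIntegralHodgeClasses.lean` (the
`ℚ`-spaces of Hodge classes `Bᵖ(X) = H^{2p}_Hodge(X) = H^{2p}(X, ℚ) ∩ H^{p,p}(X) = hodgeClasses Φ p` and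
their integral points `integralHodgeClasses Φ p`).

Read for `r = s = p`, the two printed propositions say that `F` carries the Hodge classes of
codimension `p` on `X` isomorphically onto the Hodge classes of codimension `q = g - p` on the dual
torus — H. Lange, *Abelian Varieties over the Complex Numbers* (2023), §6.2.4, held text
`book:lange1992-complex-abelian-varieties` p0310 L23 ("**Proposition 6.2.20** The Fourier transform
`F` is an isomorphism with …", restricted to `Hᵖ(X, ℤ) → H^{2g-p}(X̂, ℤ)` through `α_p`) and p0311 L9
("**Proposition 6.2.21** `F(H^{r,s}(X)) = H^{g-s,g-r}(X̂)`"): a class that is rational (resp. integral)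
and of type `(p,p)` goes to a class that is rational (resp. integral) and of type `(g-p, g-p)`, and
conversely every such class on `X̂` is reached (both preimages — the integral one of 6.2.20 and the
typed one of 6.2.21 — coincide because `F` is injective). This file records that corollary; nothing of
the two propositions is restated (the tree's `fourierForm_mem_integralForms`,
`exists_fourierForm_eq_of_mem_integralForms`, `isOfTypeAt_fourierForm`,
`exists_fourierForm_eq_of_isOfTypeAt`, `fourierForm_injective` are consumed by name).

## Contents (theorems only; no definition, no named fact, net debt 0)

* `fourierForm_mem_rationalForms` — `F(Hᵖ(X, ℚ)) ⊆ H^{2g-p}(X̂, ℚ)` (from the integral statement by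
  clearing denominators, `exists_nsmul_mem_integralForms`); `exists_mem_rationalForms_fourierForm_eq`
  (onto).
* **`fourierForm_mem_hodgeClasses`** — `F(Bᵖ(X)) ⊆ B^q(X̂)`, `p + q = g`;
  **`fourierForm_mem_integralHodgeClasses`** — the same on integral Hodge classes.
* **`exists_mem_hodgeClasses_fourierForm_eq`** — every Hodge class of codimension `q` on `X̂` is `F(x)`
  for a (unique) Hodge class `x` of codimension `p` on `X`; `exists_mem_integralHodgeClasses_fourierForm_eq`.
* **`exists_linearMap_hodgeClasses_fourierForm_bijective`** — `F` as a `ℚ`-linear BIJECTION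
  `Bᵖ(X) → B^q(X̂)` (packaged as the existence of a `ℚ`-linear map with underlying function `F`), and
  **`finrank_hodgeClasses_dualPeriod_eq`**: `dim_ℚ B^q(X̂) = dim_ℚ Bᵖ(X)` for `p + q = g`.

Scope / faithfulness: every complex torus (no polarisation needed), exactly as Prop. 6.2.20–6.2.21 on
invariant forms; the enumeration `e : Fin (2p + 2q) ≃ ι` of the lattice basis fixes `g = p + q` and the
orientation used by `p_{2*}` (`F` itself does not depend on it, `fourierForm_eq_fourierForm`); `ι`
carries a linear order as in `ComplexTorusFourierIsomorphism.lean` (lattice monomial bases).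

## References

* [Lange2023AbelianVarietiesComplex] H. Lange, *Abelian Varieties over the Complex Numbers*,
  Grundlehren Text Editions, Springer (2023), §6.2.4 Prop. 6.2.20 (p. 310), Prop. 6.2.21 (p. 311);
  Ch. 7 introduction (p. 323: the Hodge classes `H^{2p}(X, ℚ) ∩ H^{p,p}`).
* [Beauville1983Fourier] A. Beauville, Quelques remarques sur la transformation de Fourier dans
  l'anneau de Chow d'une variété abélienne, LNM 1016 (1983) 238–260 — Lange's source [15] for §6.2;
  cited through Lange, not read here.
-/

noncomputable section

open Function Module Complex
open Literature.Analysis.Complex (IsOfTypeAt)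

namespace Literature.Geometry.Kaehler

namespace ComplexTorus

variable {ι : Type*} [Fintype ι] [LinearOrder ι] {E : Type*} [NormedAddCommGroup E] [NormedSpace ℂ E]
  (Φ : (ι → ℝ) ≃L[ℝ] E) {p m : ℕ}

/-! ### Rational classes -/

/-- **`F(Hᵖ(X, ℚ)) ⊆ H^{2g-p}(X̂, ℚ)`**: the Fourier transform of a rational class is rational (a rational
class is `N⁻¹ ×` an integral class, and `F` is `ℂ`-linear and integral on integral classes, Prop. 6.2.20).
[cite: Lange2023AbelianVarietiesComplex, §6.2.4 Prop. 6.2.20 p. 310] -/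
theorem fourierForm_mem_rationalForms (e : Fin (p + m) ≃ ι) {x : E [⋀^Fin p]→L[ℝ] ℂ}
    (hx : x ∈ rationalForms Φ p) : fourierForm Φ e rfl x ∈ rationalForms (dualPeriod Φ) m := by
  obtain ⟨N, hN, hNx⟩ := exists_nsmul_mem_integralForms Φ hx
  have hF : (N : ℂ) • fourierForm Φ e rfl x ∈ rationalForms (dualPeriod Φ) m := by
    rw [← fourierForm_smul]
    exact mem_rationalForms_of_mem_integralForms _ (fourierForm_mem_integralForms Φ e hNx)
  have hN0 : (N : ℚ) ≠ 0 := by exact_mod_cast hN.ne'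
  have key : fourierForm Φ e rfl x = (N : ℚ)⁻¹ • ((N : ℂ) • fourierForm Φ e rfl x) := by
    rw [← Rat.cast_smul_eq_qsmul ℂ, smul_smul, Rat.cast_inv, Rat.cast_natCast,
      inv_mul_cancel₀ (by exact_mod_cast hN.ne' : (N : ℂ) ≠ 0), one_smul]
  rw [key]
  exact Submodule.smul_mem _ _ hF

/-- **`F : Hᵖ(X, ℚ) → H^{2g-p}(X̂, ℚ)` is onto**: every rational class on `X̂` is `F` of a rational class
on `X` (Prop. 6.2.20 over `ℤ`, divided by a denominator). [cite: Lange2023AbelianVarietiesComplex, §6.2.4 Prop. 6.2.20 p. 310] -/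
theorem exists_mem_rationalForms_fourierForm_eq (e : Fin (p + m) ≃ ι)
    {y : (E →L⋆[ℂ] ℂ) [⋀^Fin m]→L[ℝ] ℂ} (hy : y ∈ rationalForms (dualPeriod Φ) m) :
    ∃ x ∈ rationalForms Φ p, fourierForm Φ e rfl x = y := by
  obtain ⟨N, hN, hNy⟩ := exists_nsmul_mem_integralForms (dualPeriod Φ) hy
  obtain ⟨x₁, hx₁, hFx₁⟩ := exists_fourierForm_eq_of_mem_integralForms Φ e hNy
  refine ⟨(N : ℚ)⁻¹ • x₁, Submodule.smul_mem _ _ (mem_rationalForms_of_mem_integralForms Φ hx₁), ?_⟩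
  rw [← Rat.cast_smul_eq_qsmul ℂ, fourierForm_smul, hFx₁, smul_smul, Rat.cast_inv, Rat.cast_natCast,
    inv_mul_cancel₀ (by exact_mod_cast hN.ne' : (N : ℂ) ≠ 0), one_smul]

/-! ### Hodge classes -/

section Hodge

variable {p q : ℕ}

include Φ in
omit [LinearOrder ι] in
/-- `dim_ℂ E = p + q` when the lattice basis is enumerated by `Fin (2p + 2q)`.
[cite: Lange2023AbelianVarietiesComplex, §1.1.1] -/
theorem finrank_eq_add_of_equiv (e : Fin (2 * p + 2 * q) ≃ ι) : finrank ℂ E = q + p := by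
  have h := finrank_complex_mul_two Φ e
  omega

/-- **`F(Bᵖ(X)) ⊆ B^q(X̂)` (`p + q = g`)**: the Fourier transform of a Hodge class of codimension `p` on
`X` is a Hodge class of codimension `q = g - p` on the dual torus `X̂` — rational by Prop. 6.2.20, of
type `(g-p, g-p)` by Prop. 6.2.21. [cite: Lange2023AbelianVarietiesComplex, §6.2.4 Prop. 6.2.21 p. 311]
[cite: Lange2023AbelianVarietiesComplex, §6.2.4 Prop. 6.2.20 p. 310] -/
theorem fourierForm_mem_hodgeClasses (e : Fin (2 * p + 2 * q) ≃ ι) {x : E [⋀^Fin (2 * p)]→L[ℝ] ℂ}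
    (hx : x ∈ hodgeClasses Φ p) : fourierForm Φ e rfl x ∈ hodgeClasses (dualPeriod Φ) q := by
  have hg := finrank_eq_add_of_equiv Φ e
  obtain ⟨hxQ, hxT⟩ := (mem_hodgeClasses_iff Φ).1 hx
  exact (mem_hodgeClasses_iff (dualPeriod Φ)).2
    ⟨fourierForm_mem_rationalForms Φ e hxQ, isOfTypeAt_fourierForm Φ e rfl hxT hg.symm hg.symm⟩

/-- **`F` on integral Hodge classes**: `F(H^{2p}(X, ℤ) ∩ H^{p,p}) ⊆ H^{2q}(X̂, ℤ) ∩ H^{q,q}`, `p + q = g`.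
[cite: Lange2023AbelianVarietiesComplex, §6.2.4 Prop. 6.2.20 p. 310] [cite: Lange2023AbelianVarietiesComplex, §6.2.4 Prop. 6.2.21 p. 311] -/
theorem fourierForm_mem_integralHodgeClasses (e : Fin (2 * p + 2 * q) ≃ ι)
    {x : E [⋀^Fin (2 * p)]→L[ℝ] ℂ} (hx : x ∈ integralHodgeClasses Φ p) :
    fourierForm Φ e rfl x ∈ integralHodgeClasses (dualPeriod Φ) q := by
  have hg := finrank_eq_add_of_equiv Φ e
  obtain ⟨hxZ, hxT⟩ := (mem_integralHodgeClasses_iff Φ).1 hx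
  exact (mem_integralHodgeClasses_iff (dualPeriod Φ)).2
    ⟨fourierForm_mem_integralForms Φ e hxZ, isOfTypeAt_fourierForm Φ e rfl hxT hg.symm hg.symm⟩

/-- **`F : Bᵖ(X) → B^q(X̂)` is onto (`p + q = g`)**: every Hodge class of codimension `q` on `X̂` is
`F(x)` for a Hodge class `x` of codimension `p` on `X` — the rational preimage (Prop. 6.2.20) and the
preimage of type `(p,p)` (Prop. 6.2.21) coincide, `F` being injective.
[cite: Lange2023AbelianVarietiesComplex, §6.2.4 Prop. 6.2.21 p. 311] [cite: Lange2023AbelianVarietiesComplex, §6.2.4 Prop. 6.2.20 p. 310] -/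
theorem exists_mem_hodgeClasses_fourierForm_eq (e : Fin (2 * p + 2 * q) ≃ ι)
    {y : (E →L⋆[ℂ] ℂ) [⋀^Fin (2 * q)]→L[ℝ] ℂ} (hy : y ∈ hodgeClasses (dualPeriod Φ) q) :
    ∃ x ∈ hodgeClasses Φ p, fourierForm Φ e rfl x = y := by
  have hg := finrank_eq_add_of_equiv Φ e
  obtain ⟨hyQ, hyT⟩ := (mem_hodgeClasses_iff (dualPeriod Φ)).1 hy
  obtain ⟨x, hxQ, hFx⟩ := exists_mem_rationalForms_fourierForm_eq Φ e hyQ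
  obtain ⟨x', hx'T, hFx'⟩ :=
    exists_fourierForm_eq_of_isOfTypeAt Φ e (show p + p = 2 * p by omega) hg.symm hg.symm hyT
  have hxx' : x = x' := fourierForm_injective Φ e (hFx.trans hFx'.symm)
  exact ⟨x, (mem_hodgeClasses_iff Φ).2 ⟨hxQ, hxx' ▸ hx'T⟩, hFx⟩

/-- The same on integral Hodge classes: every class in `H^{2q}(X̂, ℤ) ∩ H^{q,q}` is `F(x)` for an
`x ∈ H^{2p}(X, ℤ) ∩ H^{p,p}`, `p + q = g`. [cite: Lange2023AbelianVarietiesComplex, §6.2.4 Prop. 6.2.20 p. 310]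
[cite: Lange2023AbelianVarietiesComplex, §6.2.4 Prop. 6.2.21 p. 311] -/
theorem exists_mem_integralHodgeClasses_fourierForm_eq (e : Fin (2 * p + 2 * q) ≃ ι)
    {y : (E →L⋆[ℂ] ℂ) [⋀^Fin (2 * q)]→L[ℝ] ℂ} (hy : y ∈ integralHodgeClasses (dualPeriod Φ) q) :
    ∃ x ∈ integralHodgeClasses Φ p, fourierForm Φ e rfl x = y := by
  have hg := finrank_eq_add_of_equiv Φ e
  obtain ⟨hyZ, hyT⟩ := (mem_integralHodgeClasses_iff (dualPeriod Φ)).1 hy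
  obtain ⟨x, hxZ, hFx⟩ := exists_fourierForm_eq_of_mem_integralForms Φ e hyZ
  obtain ⟨x', hx'T, hFx'⟩ :=
    exists_fourierForm_eq_of_isOfTypeAt Φ e (show p + p = 2 * p by omega) hg.symm hg.symm hyT
  have hxx' : x = x' := fourierForm_injective Φ e (hFx.trans hFx'.symm)
  exact ⟨x, (mem_integralHodgeClasses_iff Φ).2 ⟨hxZ, hxx' ▸ hx'T⟩, hFx⟩

/-- **`F : Bᵖ(X) ⥲ B^q(X̂)` as a `ℚ`-linear bijection** (`p + q = g`), packaged as the existence of a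
`ℚ`-linear map between the spaces of Hodge classes whose underlying function is the Fourier transform.
[cite: Lange2023AbelianVarietiesComplex, §6.2.4 Prop. 6.2.20 p. 310] [cite: Lange2023AbelianVarietiesComplex, §6.2.4 Prop. 6.2.21 p. 311] -/
theorem exists_linearMap_hodgeClasses_fourierForm_bijective (e : Fin (2 * p + 2 * q) ≃ ι) :
    ∃ F : hodgeClasses Φ p →ₗ[ℚ] hodgeClasses (dualPeriod Φ) q,
      (∀ x, (F x : (E →L⋆[ℂ] ℂ) [⋀^Fin (2 * q)]→L[ℝ] ℂ) = fourierForm Φ e rfl x) ∧ Bijective F := by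
  let F : hodgeClasses Φ p →ₗ[ℚ] hodgeClasses (dualPeriod Φ) q :=
    { toFun := fun x ↦ ⟨fourierForm Φ e rfl x, fourierForm_mem_hodgeClasses Φ e x.2⟩
      map_add' := fun x x' ↦ Subtype.ext (by
        simp only [Submodule.coe_add]
        exact fourierForm_add Φ e rfl _ _)
      map_smul' := fun c x ↦ Subtype.ext (by
        simp only [Submodule.coe_smul, RingHom.id_apply]
        rw [← Rat.cast_smul_eq_qsmul ℂ c, fourierForm_smul, Rat.cast_smul_eq_qsmul]) }
  refine ⟨F, fun x ↦ rfl, fun x x' h ↦ Subtype.ext (fourierForm_injective Φ e ?_), fun y ↦ ?_⟩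
  · exact congrArg Subtype.val h
  · obtain ⟨x, hx, hFx⟩ := exists_mem_hodgeClasses_fourierForm_eq Φ e y.2
    exact ⟨⟨x, hx⟩, Subtype.ext hFx⟩

/-- **`dim_ℚ B^q(X̂) = dim_ℚ Bᵖ(X)` for `p + q = g`**: the dual complex torus has as many Hodge
classes in the complementary codimension as `X` (Fourier transform, Prop. 6.2.20–6.2.21).
[cite: Lange2023AbelianVarietiesComplex, §6.2.4 Prop. 6.2.21 p. 311] -/
theorem finrank_hodgeClasses_dualPeriod_eq (e : Fin (2 * p + 2 * q) ≃ ι) :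
    finrank ℚ (hodgeClasses (dualPeriod Φ) q) = finrank ℚ (hodgeClasses Φ p) := by
  obtain ⟨F, -, hF⟩ := exists_linearMap_hodgeClasses_fourierForm_bijective Φ e (p := p) (q := q)
  exact ((LinearEquiv.ofBijective F hF).finrank_eq).symm

end Hodge

end ComplexTorus

end Literature.Geometry.Kaehler

end
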